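import Summits.ValiantsHypothesis.ValiantsHypothesis.Theorems.LacunarySymmetroidMatrixDescartesOverlapWindowCoeff
import Literature.LinearAlgebra.Matrix.ConverseInterlacing

/-!
# `MatrixDescartes` — the RANK-ONE WINDOW LAW for all sizes: a rank-one letter's window sees the adjugate compression

HONEST FRAMING.  Object-search cell `pub-symmetroid`, crux `Theses.LacunarySymmetroid.MatrixDescartes` (ledger item
`stmt-ValiantsHypothesis-18050`, route `LacunarySymmetroid`; seat `val-sym-mdr-p2`, gen 13).  The crux implies `VP ≠ VNP`
by the route's assembly; NOTHING here is progress on it, and nothing here is a claim about `VP ≠ VNP`, `DoorA26` /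
`DoorA34` or the cell's registers.  Sequel of `…OverlapWindowCoeff` (robust Descartes rule in coefficient currency) and
`…OverlapRankOneTwo(Law)` (the case `m = 2`).

THE IDENTITY (`det_pencil_eq_of_rankOne_adjugate`, every size `m`).  If the letter `t` of the real lacunary pencil
`F = ∑ₗ X^(d l) • S l` has rank one, `S t = a·w wᵀ`, then by Cauchy's rank-one formula (tree
`Literature.LinearAlgebra.Matrix.det_add_vecMulVec_adjugate`, no invertibility needed)
  `det F = det F_¬t + C a · X^(d t) · wᵀ adj(F_¬t) w`,
the ADJUGATE COMPRESSION of the other letters along `w` — for symmetric `F_¬t` this is the level-1 polynomial of the cell's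
FLAG LEMMA (CONJECTURE §2.1c: `p₁ = det(F compressed to w⊥)` up to the frame), a sum of `(m−1)×(m−1)` minors, i.e. a
pencil-like polynomial of degree `m − 1` in the `K − 1` other letters with at most `C(m+K−3, m−1)` monomials.
THE LAW (`card_roots_Icc_le_of_rankOne`, coefficient currency).  Choose a survivor exponent `n⋆` and real cuts `A` containing
every other exponent of `X^(d t)·wᵀadj(F_¬t)w`.  If at the two endpoints of a window `[u, v] ⊂ (0, ∞)` the `|∏(n − α)|`-weighted
absolute mass of ALL coefficients of `det F_¬t` other than at `n⋆`, plus the weighted `|coeff(det F_¬t) n⋆|·x^n⋆`, is below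
`|∏(n⋆ − α)|·|a|·|coeff(wᵀadj(F_¬t)w)(n⋆ − d t)|·x^n⋆`, then `det F` has at most `#A` distinct zeros in `[u, v]` — with the
canonical cuts, the Descartes count `D(m−1, K−1) − 1` of the compression: the FLAG LEMMA's level-1 increment read from above
(`ζ(m,K+1) ≥ ζ(m,K) + m + Σγ_j` from below; here: a rank-one end window costs at most the compression's Descartes count).
Where `t` dominates in norm by a factor `Λ`, the coefficients of `det F_¬t` are `O(Λ⁻¹)` against `a·x^(d t)·(minors)`, so the
certificate is the non-degeneracy of the compression's surviving coefficient.  ARBITRARY real letters otherwise.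
[folklore] (Laguerre's method; Cauchy's rank-one determinant formula, Horn–Johnson (0.8.5.11)).
-/

-- `Summit.ValiantsHypothesis.ValiantsHypothesis.…` repeats a component by the D-0017 layout (single-conjunct summit).
set_option linter.dupNamespace false

namespace Summit.ValiantsHypothesis.ValiantsHypothesis.Theorems.LacunarySymmetroidMatrixDescartes.Overlap

open Polynomial Finset Set
open scoped BigOperators Matrix

variable {K m : ℕ}

/-! ## §19 The identity: `det F = det F_¬t + C a · X^(d t) · wᵀ adj(F_¬t) w` -/

/-- **A rank-one letter's window sees the adjugate compression (all `m`).**  With `S t = a·w wᵀ`: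
`det (∑ₗ X^(d l) • S l) = det G + C a · X^(d t) · (w ⬝ᵥ adj(G) w)` where `G = ∑_{l ≠ t} X^(d l) • S l` and `w` is read
with constant-polynomial entries. [folklore] -/
theorem det_pencil_eq_of_rankOne_adjugate (d : Fin K → ℕ) (S : Fin K → Matrix (Fin m) (Fin m) ℝ) (t : Fin K) (a : ℝ)
    (w : Fin m → ℝ) (ht : S t = a • Matrix.vecMulVec w w) :
    Matrix.det (∑ l, ((X : ℝ[X]) ^ d l) • (S l).map C) =
      Matrix.det (∑ l ∈ Finset.univ.erase t, ((X : ℝ[X]) ^ d l) • (S l).map C) +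
        C a * X ^ (d t) * ((fun i => C (w i)) ⬝ᵥ
          ((Matrix.adjugate (∑ l ∈ Finset.univ.erase t, ((X : ℝ[X]) ^ d l) • (S l).map C)) *ᵥ (fun i => C (w i)))) := by
  classical
  set G : Matrix (Fin m) (Fin m) ℝ[X] := ∑ l ∈ Finset.univ.erase t, ((X : ℝ[X]) ^ d l) • (S l).map C with hG
  have hsplit : (∑ l, ((X : ℝ[X]) ^ d l) • (S l).map C) =
      G + Matrix.vecMulVec ((C a * X ^ (d t)) • fun i => C (w i)) (fun i => C (w i)) := by
    rw [← Finset.add_sum_erase _ _ (Finset.mem_univ t), hG, add_comm]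
    congr 1
    rw [ht]
    ext i j
    simp only [Matrix.smul_apply, Matrix.map_apply, Matrix.vecMulVec_apply, smul_eq_mul, C_mul, Pi.smul_apply]
    ring
  rw [hsplit, Literature.LinearAlgebra.Matrix.det_add_vecMulVec_adjugate, Matrix.mulVec_smul, dotProduct_smul,
    smul_eq_mul]

/-- **Coefficients.**  `coeff(det F) n = coeff(det G) n + a·coeff(wᵀadj(G)w)(n − d t)` for `n ≥ d t`, and `= coeff(det G) n` for
`n < d t`. [folklore] -/
theorem coeff_det_pencil_of_rankOne_adjugate (d : Fin K → ℕ) (S : Fin K → Matrix (Fin m) (Fin m) ℝ) (t : Fin K) (a : ℝ)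
    (w : Fin m → ℝ) (ht : S t = a • Matrix.vecMulVec w w) (n : ℕ) :
    (Matrix.det (∑ l, ((X : ℝ[X]) ^ d l) • (S l).map C)).coeff n =
      (Matrix.det (∑ l ∈ Finset.univ.erase t, ((X : ℝ[X]) ^ d l) • (S l).map C)).coeff n +
        (if d t ≤ n then a * ((fun i => C (w i)) ⬝ᵥ
          ((Matrix.adjugate (∑ l ∈ Finset.univ.erase t, ((X : ℝ[X]) ^ d l) • (S l).map C)) *ᵥ (fun i => C (w i)))).coeff
            (n - d t) else 0) := by
  rw [det_pencil_eq_of_rankOne_adjugate d S t a w ht, coeff_add, mul_assoc, coeff_C_mul, coeff_X_pow_mul']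
  split_ifs <;> simp

/-! ## §20 The rank-one window law (all `m`, coefficient currency) -/

/-- **RANK-ONE WINDOW LAW (all `m`).**  `S t = a·w wᵀ`; `G = F_¬t`; `Q = wᵀ adj(G) w` (the adjugate compression); survivor exponent
`n⋆ ≥ d t`; real cuts `A` containing `(n : ℝ)` for every `n ≠ n⋆` with `coeff Q (n − d t) ≠ 0` and `n ≥ d t`.  If at `x = u, v`
(`0 < u ≤ v`):
`∑_{n ∈ supp(det G), n ≠ n⋆} |∏(n−α)|·|coeff(det G) n|·x^n + |∏(n⋆−α)|·|coeff(det G) n⋆|·x^n⋆ < |∏(n⋆−α)|·|a·coeff Q (n⋆ − d t)|·x^n⋆`,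
then `det F` has at most `#A` distinct zeros in `[u, v]`. [folklore] -/
theorem card_roots_Icc_le_of_rankOne (d : Fin K → ℕ) (S : Fin K → Matrix (Fin m) (Fin m) ℝ) (t : Fin K) (a : ℝ)
    (w : Fin m → ℝ) (ht : S t = a • Matrix.vecMulVec w w) (nstar : ℕ) (hn : d t ≤ nstar) (A : Finset ℝ)
    (hA : ∀ n : ℕ, d t ≤ n → n ≠ nstar →
      ((fun i => C (w i)) ⬝ᵥ ((Matrix.adjugate (∑ l ∈ Finset.univ.erase t, ((X : ℝ[X]) ^ d l) • (S l).map C)) *ᵥ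
        (fun i => C (w i)))).coeff (n - d t) ≠ 0 → (n : ℝ) ∈ A)
    {u v : ℝ} (hu : 0 < u) (huv : u ≤ v)
    (hdom : ∀ x : ℝ, (x = u ∨ x = v) →
      (∑ n ∈ (Matrix.det (∑ l ∈ Finset.univ.erase t, ((X : ℝ[X]) ^ d l) • (S l).map C)).support.filter
          (fun n => n ≠ nstar),
        |∏ α ∈ A, ((n : ℝ) - α)| *
          |(Matrix.det (∑ l ∈ Finset.univ.erase t, ((X : ℝ[X]) ^ d l) • (S l).map C)).coeff n| * x ^ n)
      + |∏ α ∈ A, ((nstar : ℝ) - α)| *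
          |(Matrix.det (∑ l ∈ Finset.univ.erase t, ((X : ℝ[X]) ^ d l) • (S l).map C)).coeff nstar| * x ^ nstar
      < |∏ α ∈ A, ((nstar : ℝ) - α)| *
          |a * ((fun i => C (w i)) ⬝ᵥ ((Matrix.adjugate (∑ l ∈ Finset.univ.erase t, ((X : ℝ[X]) ^ d l) • (S l).map C)) *ᵥ
            (fun i => C (w i)))).coeff (nstar - d t)| * x ^ nstar) :
    ((Matrix.det (∑ l, ((X : ℝ[X]) ^ d l) • (S l).map C)).roots.toFinset.filter
        (fun x => x ∈ Icc u v)).card ≤ A.card := by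
  classical
  set P : ℝ[X] := Matrix.det (∑ l, ((X : ℝ[X]) ^ d l) • (S l).map C) with hP
  set G : ℝ[X] := Matrix.det (∑ l ∈ Finset.univ.erase t, ((X : ℝ[X]) ^ d l) • (S l).map C) with hG
  set Q : ℝ[X] := (fun i => C (w i)) ⬝ᵥ ((Matrix.adjugate (∑ l ∈ Finset.univ.erase t, ((X : ℝ[X]) ^ d l) • (S l).map C))
    *ᵥ (fun i => C (w i))) with hQ
  -- coefficient bookkeeping
  have hcoeff : ∀ n : ℕ, P.coeff n = G.coeff n + (if d t ≤ n then a * Q.coeff (n - d t) else 0) := fun n => by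
    rw [hP, hG, hQ]; exact coeff_det_pencil_of_rankOne_adjugate d S t a w ht n
  have hcoeff_star : P.coeff nstar = G.coeff nstar + a * Q.coeff (nstar - d t) := by
    rw [hcoeff, if_pos hn]
  have hcoeff_off : ∀ n : ℕ, n ≠ nstar → (n : ℝ) ∉ A → P.coeff n = G.coeff n := by
    intro n hne hnA
    rw [hcoeff]
    split_ifs with hle
    · by_cases hq : Q.coeff (n - d t) = 0
      · rw [hq, mul_zero, add_zero]
      · exact absurd (hA n hle hne hq) hnA
    · rw [add_zero]
  refine card_roots_Icc_le_coeff P A nstar hu huv fun x hx => ?_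
  have hx0 : 0 < x := by rcases hx with rfl | rfl; exact hu; exact hu.trans_le huv
  have h := hdom x hx
  have hsumP : ∑ n ∈ P.support.filter (fun n => n ≠ nstar), |∏ α ∈ A, ((n : ℝ) - α)| * |P.coeff n| * x ^ n ≤
      ∑ n ∈ G.support.filter (fun n => n ≠ nstar), |∏ α ∈ A, ((n : ℝ) - α)| * |G.coeff n| * x ^ n := by
    have hle : ∀ n : ℕ, n ≠ nstar → |∏ α ∈ A, ((n : ℝ) - α)| * |P.coeff n| * x ^ n =
        |∏ α ∈ A, ((n : ℝ) - α)| * |G.coeff n| * x ^ n := by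
      intro n hne
      by_cases hnA : (n : ℝ) ∈ A
      · rw [Finset.prod_eq_zero hnA (sub_self _), abs_zero, zero_mul, zero_mul, zero_mul, zero_mul]
      · rw [hcoeff_off n hne hnA]
    calc ∑ n ∈ P.support.filter (fun n => n ≠ nstar), |∏ α ∈ A, ((n : ℝ) - α)| * |P.coeff n| * x ^ n
        = ∑ n ∈ P.support.filter (fun n => n ≠ nstar), |∏ α ∈ A, ((n : ℝ) - α)| * |G.coeff n| * x ^ n :=
          Finset.sum_congr rfl fun n hn' => hle n (Finset.mem_filter.1 hn').2
      _ ≤ ∑ n ∈ (P.support ∪ G.support).filter (fun n => n ≠ nstar), |∏ α ∈ A, ((n : ℝ) - α)| * |G.coeff n| * x ^ n :=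
          Finset.sum_le_sum_of_subset_of_nonneg (Finset.filter_subset_filter _ Finset.subset_union_left)
            (fun n _ _ => mul_nonneg (mul_nonneg (abs_nonneg _) (abs_nonneg _)) (pow_nonneg hx0.le _))
      _ = ∑ n ∈ G.support.filter (fun n => n ≠ nstar), |∏ α ∈ A, ((n : ℝ) - α)| * |G.coeff n| * x ^ n := by
          symm
          refine Finset.sum_subset (Finset.filter_subset_filter _ Finset.subset_union_right) fun n hn' hnot => ?_
          rw [Finset.mem_filter] at hn'
          have hnG : n ∉ G.support := fun hmem => hnot (Finset.mem_filter.2 ⟨hmem, hn'.2⟩)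
          rw [mem_support_iff, not_not] at hnG
          rw [hnG, abs_zero, mul_zero, zero_mul]
  have hsurv : |∏ α ∈ A, ((nstar : ℝ) - α)| * |a * Q.coeff (nstar - d t)| * x ^ nstar -
      |∏ α ∈ A, ((nstar : ℝ) - α)| * |G.coeff nstar| * x ^ nstar
      ≤ |∏ α ∈ A, ((nstar : ℝ) - α)| * |P.coeff nstar| * x ^ nstar := by
    rw [hcoeff_star, ← sub_mul, ← mul_sub]
    refine mul_le_mul_of_nonneg_right (mul_le_mul_of_nonneg_left ?_ (abs_nonneg _)) (pow_nonneg hx0.le _)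
    have h3 : |a * Q.coeff (nstar - d t)| ≤ |G.coeff nstar + a * Q.coeff (nstar - d t)| + |G.coeff nstar| := by
      have := abs_add_le (G.coeff nstar + a * Q.coeff (nstar - d t)) (-(G.coeff nstar))
      rwa [abs_neg, show G.coeff nstar + a * Q.coeff (nstar - d t) + -G.coeff nstar = a * Q.coeff (nstar - d t) by ring]
        at this
    linarith
  linarith [hsumP, hsurv, h]

end Summit.ValiantsHypothesis.ValiantsHypothesis.Theorems.LacunarySymmetroidMatrixDescartes.Overlap
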